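import Mathlib
import HarnessLib
import Summits.Ventures.LatticeQCDFlow.Exactness.HeatBathSweepErgodic
import Summits.Ventures.LatticeQCDFlow.Exactness.U1MetropolisLinkErgodic

/-!
# Metropolis-within-Gibbs on a finite product: a scan of single-site Metropolis hits with symmetric proposals is exact, and Doeblin when the proposals dominate the reference

HONEST FRAMING: exact (Metropolis-corrected) sampling algorithms for lattice gauge theory;
figures of merit are autocorrelation/cost numbers at stated couplings and volumes; no
continuum-physics claim.

Venture `LatticeQCDFlow` (cell pub-lqcd), topic `Exactness`, FANOUT row 9 (eng-latcore; the
engine's single-variable Metropolis updates — `cpn_2d` mode `'metro'` (sites: angular-Gaussian kick,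
links: wrapped-Gaussian kick), `phi4_2d.sweep_metropolis`, and any site-by-site Metropolis scan).
NEW WORK of the cell over the tree (`SymmetricMetropolis.lean`: `symMH`, `symMH_apply`,
`symMH_isReversible`; `U1MetropolisLinkErgodic.smul_proposal_le_symMH`: a pinched weight makes one
hit dominate `(m/M)×` its proposal; `RefreshScan.lean`: `siteLift`, `refresh`, `cycle_minorised`,
`cycle_refresh_eq_const`, `lintegral_pi_lmarginal`, `uniformlyErgodic_of_minorised`;
`HeatBathSweepErgodic.lean`: `piGibbsLaw`; `DoeblinUniqueness.lean`).  Nothing is cited as a fact.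
Printed counterparts, named only: Metropolis et al. 1953; Tierney 1994 (Metropolis-within-Gibbs);
Meyn–Tweedie Thm 16.0.2.  The Metropolis twin of `HeatBathSweepErgodic.lean`.

## Setting and content

A finite dependent product `Π j, X j` with reference probability laws `μ_j`, a measurable REAL
weight `w` (target `w · ⊗μ`), and for every site a Markov proposal kernel `P_i` on `X i`.

* §1 `siteMHLaw μ P w i` — from `ω`, propose `ξ ∼ P_i(ω_i, ·)`, accept with
  `min(1, w(ω|ω_i:=ξ)/w(ω))`, else keep `ω_i` (a kernel `(Π j, X j) → X i`); **`siteMHLaw_apply`** —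
  it IS `symMH (P i) (w ∘ update ω i) (ω i)`; `siteMetropolis = siteLift i (siteMHLaw …)`; Markov.
* §2 **`siteMetropolis_isReversible`** — if `P_i` is `μ_i`-symmetric
  (`(μ_i ⊗ₘ P_i).map swap = μ_i ⊗ₘ P_i`) and `w > 0` is measurable, the site hit is REVERSIBLE for
  `w · ⊗μ` (integrate out site `i` first; on each fibre it is `symMH_isReversible`); hence invariant;
  **`metropolisScan_invariant`** for every list of sites.
* §3 (pinched weight `0 < m ≤ w ≤ M`, proposals dominating the reference: `c • μ_i ≤ P_i(x, ·)` for
  all `x`) **`siteMetropolis_ge_refresh`** — each hit dominates `(c·m/M) ×` the free refresh of its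
  site; **`metropolisScan_minorised`** — a scan over a list containing every site dominates
  `(c m/M)^{|l|} · ⊗μ` from EVERY configuration; **`metropolisScan_uniformlyErgodic`** —
  `|μ₀Kᵗ(A) − π(A)| ≤ (1 − (c m/M)^{|l|})ᵗ` with `π = piGibbsLaw μ (ofReal ∘ w)`;
  **`metropolisScan_invariant_unique`**.

NOT CLAIMED: site-dependent constants `c_i` (one `c` for all sites, for brevity); non-symmetric
proposals (Hastings corrections); unbounded weights.
-/

noncomputable section

namespace Summit.Ventures.LatticeQCDFlow.Exactness

open MeasureTheory ProbabilityTheory Function Set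
open scoped ENNReal

/-! ## §1 The single-site Metropolis hit on the product space -/

section Site

variable {ι : Type*} [DecidableEq ι] {X : ι → Type*} [∀ i, MeasurableSpace (X i)]
variable (μ : Π i, Measure (X i)) [∀ i, IsProbabilityMeasure (μ i)]
variable (P : Π i, Kernel (X i) (X i)) [∀ i, IsMarkovKernel (P i)] (w : (Π j, X j) → ℝ)

/-- **The one-site Metropolis law**: from `ω`, propose `ξ ∼ P_i(ω_i, ·)`, accept with
`min(1, w(ω|ω_i := ξ)/w(ω))`, else keep `ω_i`. -/
def siteMHLaw (i : ι) : Kernel (Π j, X j) (X i) :=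
  Kernel.withDensity (Kernel.comap (P i) (fun ω : Π j, X j => ω i) (measurable_pi_apply i))
      (fun ω ξ => imhAcceptE (fun x => w (update ω i x)) (ω i) ξ) +
    Kernel.withDensity (Kernel.deterministic (fun ω : Π j, X j => ω i) (measurable_pi_apply i))
      (fun ω _ => 1 - symAcceptMass (P i) (fun x => w (update ω i x)) (ω i))

/-- **The single-site Metropolis hit** on the product space: site `i` updated by `siteMHLaw`, the
other coordinates frozen. -/
def siteMetropolis (i : ι) : Kernel (Π j, X j) (Π j, X j) := siteLift i (siteMHLaw P w i)

variable {μ P w}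

omit [∀ i, IsMarkovKernel (P i)] in
/-- Joint measurability of the acceptance `((ω, ξ) ↦ min(1, w(ω|ξ)/w(ω|ω_i)))`. -/
theorem measurable_siteAccept (hw : Measurable w) (i : ι) :
    Measurable (uncurry fun (ω : Π j, X j) (ξ : X i) => imhAcceptE (fun x => w (update ω i x)) (ω i) ξ) := by
  unfold imhAcceptE imhAccept
  refine (measurable_const.min ((hw.comp measurable_update').div ?_)).ennreal_ofReal
  exact hw.comp (measurable_update'.comp (measurable_fst.prodMk ((measurable_pi_apply i).comp measurable_fst)))

omit [∀ i, IsMarkovKernel (P i)] in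
/-- Measurability of the acceptance mass. -/
theorem measurable_siteAcceptMass [∀ i, IsSFiniteKernel (P i)] (hw : Measurable w) (i : ι) :
    Measurable fun ω : Π j, X j => symAcceptMass (P i) (fun x => w (update ω i x)) (ω i) := by
  have h := (measurable_siteAccept hw i).lintegral_kernel_prod_right
    (κ := (Kernel.comap (P i) (fun ω : Π j, X j => ω i) (measurable_pi_apply i)))
  simpa [symAcceptMass, Kernel.comap_apply] using h

/-- The one-site law is an s-finite kernel. -/
instance isSFiniteKernel_siteMHLaw (i : ι) : IsSFiniteKernel (siteMHLaw P w i) := by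
  haveI h1 : IsSFiniteKernel (Kernel.withDensity
      (Kernel.comap (P i) (fun ω : Π j, X j => ω i) (measurable_pi_apply i))
      (fun (ω : Π j, X j) (ξ : X i) => imhAcceptE (fun x => w (update ω i x)) (ω i) ξ)) :=
    Kernel.IsSFiniteKernel.withDensity _
      (fun ω ξ => ne_top_of_le_ne_top ENNReal.one_ne_top (imhAcceptE_le_one _ _ _))
  haveI h2 : IsSFiniteKernel (Kernel.withDensity
      (Kernel.deterministic (fun ω : Π j, X j => ω i) (measurable_pi_apply i))
      (fun (ω : Π j, X j) (_ : X i) => 1 - symAcceptMass (P i) (fun x => w (update ω i x)) (ω i))) :=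
    Kernel.IsSFiniteKernel.withDensity _ (fun ω _ => ne_top_of_le_ne_top ENNReal.one_ne_top tsub_le_self)
  unfold siteMHLaw; infer_instance

/-- **The one-site law IS the symmetric-proposal Metropolis kernel of the fibre**:
`siteMHLaw ω = symMH (P i) (w ∘ update ω i) (ω i)`. -/
theorem siteMHLaw_apply (hw : Measurable w) (i : ι) (ω : Π j, X j) :
    siteMHLaw P w i ω = symMH (P i) (fun x => w (update ω i x)) (ω i) := by
  ext s hs
  have hwω : Measurable fun x => w (update ω i x) := hw.comp (measurable_update ω)
  have h2 : Measurable (uncurry fun (ω : Π j, X j) (_ : X i) =>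
      1 - symAcceptMass (P i) (fun x => w (update ω i x)) (ω i)) :=
    measurable_const.sub ((measurable_siteAcceptMass (P := P) hw i).comp measurable_fst)
  rw [siteMHLaw, Kernel.add_apply, Measure.add_apply,
    Kernel.withDensity_apply' _ (measurable_siteAccept hw i), Kernel.withDensity_apply' _ h2,
    Kernel.comap_apply, Kernel.deterministic_apply, symMH_apply hwω (ω i) hs, setLIntegral_const,
    Measure.dirac_apply' _ hs]

/-- The one-site law is Markov. -/
theorem isMarkovKernel_siteMHLaw (hw : Measurable w) (i : ι) : IsMarkovKernel (siteMHLaw P w i) := by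
  refine ⟨fun ω => ?_⟩
  haveI : Fact (Measurable fun x => w (update ω i x)) := ⟨hw.comp (measurable_update ω)⟩
  rw [siteMHLaw_apply hw]
  infer_instance

/-- The site hit is Markov. -/
theorem isMarkovKernel_siteMetropolis (hw : Measurable w) (i : ι) : IsMarkovKernel (siteMetropolis P w i) := by
  haveI := isMarkovKernel_siteMHLaw (P := P) hw i
  unfold siteMetropolis siteLift
  exact Kernel.IsMarkovKernel.map _ measurable_update'

/-- Setwise formula for the site hit through the fibre kernel. -/
theorem siteMetropolis_apply (hw : Measurable w) (i : ι) (ω : Π j, X j) {s : Set (Π j, X j)} (hs : MeasurableSet s) :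
    siteMetropolis P w i ω s = symMH (P i) (fun x => w (update ω i x)) (ω i) (update ω i ⁻¹' s) := by
  rw [siteMetropolis, siteLift_apply, Measure.map_apply (measurable_update ω) hs, siteMHLaw_apply hw]

/-- The site hit does not read the coordinate it proposes from beyond the current value: on the fibre
through `x`, at the point `update x i ξ`, it is the fibre kernel at `ξ`. -/
theorem siteMetropolis_update_apply (hw : Measurable w) (i : ι) (x : Π j, X j) (ξ : X i)
    {s : Set (Π j, X j)} (hs : MeasurableSet s) :
    siteMetropolis P w i (update x i ξ) s = symMH (P i) (fun y => w (update x i y)) ξ (update x i ⁻¹' s) := by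
  have hfun : update (update x i ξ) i = update x i := funext fun η => update_idem _ _ _
  rw [siteMetropolis_apply hw i _ hs, hfun, update_self]

/-! ## §2 Exactness: symmetric proposals -/

variable [Fintype ι]

/-- **THE SINGLE-SITE METROPOLIS HIT IS EXACT**: if the proposal `P_i` is `μ_i`-symmetric, then for
every measurable weight `w > 0` the site hit is reversible for `w · ⊗μ`. -/
theorem siteMetropolis_isReversible (hw : Measurable w) (hw0 : ∀ ω, 0 < w ω) {i : ι}
    (hP : ((μ i) ⊗ₘ P i).map Prod.swap = (μ i) ⊗ₘ P i) :
    Kernel.IsReversible (siteMetropolis P w i) ((Measure.pi μ).withDensity fun ω => ENNReal.ofReal (w ω)) := by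
  intro A B hA hB
  have hW : Measurable fun ω : Π j, X j => ENNReal.ofReal (w ω) := hw.ennreal_ofReal
  -- integrate out site `i` first: the flow `A → B` as an integral over the fibres
  have key : ∀ {A B : Set (Π j, X j)}, MeasurableSet A → MeasurableSet B →
      ∫⁻ ω in A, siteMetropolis P w i ω B ∂(Measure.pi μ).withDensity (fun ω => ENNReal.ofReal (w ω)) =
        ∫⁻ x, (∫⁻ ξ in update x i ⁻¹' A, symMH (P i) (fun y => w (update x i y)) ξ (update x i ⁻¹' B)
          ∂((μ i).withDensity fun ξ => ENNReal.ofReal (w (update x i ξ)))) ∂Measure.pi μ := by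
    intro A B hA hB
    have hK : Measurable fun ω => siteMetropolis P w i ω B := Kernel.measurable_coe _ hB
    rw [setLIntegral_withDensity_eq_setLIntegral_mul _ hW hK hA, ← lintegral_indicator hA,
      ← lintegral_pi_lmarginal (μ := μ) i ((hW.mul hK).indicator hA)]
    refine lintegral_congr fun x => ?_
    rw [lmarginal_singleton]
    have hwx : Measurable fun ξ => ENNReal.ofReal (w (update x i ξ)) := (hw.comp (measurable_update x)).ennreal_ofReal
    have hKx : Measurable fun ξ => symMH (P i) (fun y => w (update x i y)) ξ (update x i ⁻¹' B) :=
      haveI : Fact (Measurable fun y => w (update x i y)) := ⟨hw.comp (measurable_update x)⟩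
      Kernel.measurable_coe _ ((measurable_update x) hB)
    rw [setLIntegral_withDensity_eq_setLIntegral_mul _ hwx hKx ((measurable_update x) hA),
      ← lintegral_indicator ((measurable_update x) hA)]
    refine lintegral_congr fun ξ => ?_
    by_cases h : update x i ξ ∈ A
    · rw [indicator_of_mem h, indicator_of_mem (show ξ ∈ update x i ⁻¹' A from h), Pi.mul_apply, Pi.mul_apply,
        siteMetropolis_update_apply hw i x ξ hB]
    · rw [indicator_of_notMem h, indicator_of_notMem (show ξ ∉ update x i ⁻¹' A from h)]
  rw [key hA hB, key hB hA]
  refine lintegral_congr fun x => ?_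
  exact symMH_isReversible (hw.comp (measurable_update x)) (fun y => hw0 _) hP ((measurable_update x) hA)
    ((measurable_update x) hB)

/-- … hence `w · ⊗μ` is invariant under the site hit. -/
theorem siteMetropolis_invariant (hw : Measurable w) (hw0 : ∀ ω, 0 < w ω) {i : ι}
    (hP : ((μ i) ⊗ₘ P i).map Prod.swap = (μ i) ⊗ₘ P i) :
    Kernel.Invariant (siteMetropolis P w i) ((Measure.pi μ).withDensity fun ω => ENNReal.ofReal (w ω)) := by
  haveI := isMarkovKernel_siteMetropolis (P := P) hw i
  exact (siteMetropolis_isReversible (μ := μ) hw hw0 hP).invariant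

/-- **Metropolis scans are exact**: a cycle of site hits over any list of sites leaves `w · ⊗μ`
invariant (all proposals symmetric). -/
theorem metropolisScan_invariant (hw : Measurable w) (hw0 : ∀ ω, 0 < w ω)
    (hP : ∀ i, ((μ i) ⊗ₘ P i).map Prod.swap = (μ i) ⊗ₘ P i) (l : List ι) :
    Kernel.Invariant (cycle (l.map (siteMetropolis P w))) ((Measure.pi μ).withDensity fun ω => ENNReal.ofReal (w ω)) := by
  refine invariant_cycle fun κ hκ => ?_
  obtain ⟨i, -, rfl⟩ := List.mem_map.1 hκ
  exact siteMetropolis_invariant hw hw0 (hP i)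

/-! ## §3 Pinched weight and dominating proposals: Doeblin, uniform ergodicity, uniqueness -/

variable {m M : ℝ} {c : ℝ≥0∞}

omit [Fintype ι] in
/-- **Each site hit dominates `(c·m/M) ×` the free refresh of its site** when the proposals dominate
`c • μ_i` from every point and `0 < m ≤ w ≤ M`. -/
theorem siteMetropolis_ge_refresh (hw : Measurable w) (hm : 0 < m) (hwm : ∀ ω, m ≤ w ω) (hwM : ∀ ω, w ω ≤ M)
    (hc : ∀ i x, c • μ i ≤ P i x) (i : ι) (ω : Π j, X j) :
    (c * ENNReal.ofReal (m / M)) • refresh μ i ω ≤ siteMetropolis P w i ω := by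
  refine Measure.le_iff.2 fun s hs => ?_
  have hind : (fun ξ : X i => s.indicator (1 : (Π j, X j) → ℝ≥0∞) (update ω i ξ)) = (update ω i ⁻¹' s).indicator 1 := by
    funext ξ
    by_cases h : update ω i ξ ∈ s
    · rw [indicator_of_mem h, indicator_of_mem (show ξ ∈ update ω i ⁻¹' s from h)]; rfl
    · rw [indicator_of_notMem h, indicator_of_notMem (show ξ ∉ update ω i ⁻¹' s from h)]
  rw [Measure.smul_apply, smul_eq_mul, siteMetropolis_apply hw i ω hs, ← lintegral_indicator_one hs,
    lintegral_refresh i ω (measurable_one.indicator hs), lmarginal_singleton]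
  change c * ENNReal.ofReal (m / M) * ∫⁻ ξ, s.indicator (1 : (Π j, X j) → ℝ≥0∞) (update ω i ξ) ∂μ i ≤ _
  rw [hind, lintegral_indicator_one ((measurable_update ω) hs)]
  have h1 := Measure.le_iff.1 (smul_proposal_le_symMH (P := P i) (hw.comp (measurable_update ω)) hm
    (fun x => hwm _) (fun x => hwM _) (ω i)) _ ((measurable_update ω) hs)
  have h2 := Measure.le_iff.1 (hc i (ω i)) _ ((measurable_update ω) hs)
  rw [Measure.smul_apply, smul_eq_mul] at h1 h2
  calc c * ENNReal.ofReal (m / M) * μ i (update ω i ⁻¹' s)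
      = ENNReal.ofReal (m / M) * (c * μ i (update ω i ⁻¹' s)) := by ring
    _ ≤ ENNReal.ofReal (m / M) * P i (ω i) (update ω i ⁻¹' s) := mul_le_mul' le_rfl h2
    _ ≤ symMH (P i) (fun x => w (update ω i x)) (ω i) (update ω i ⁻¹' s) := h1

/-- **DOEBLIN FOR THE METROPOLIS SCAN**: a scan of site hits over a list `l` containing every site
dominates `(c m/M)^{|l|} ×` the product law, from EVERY configuration. -/
theorem metropolisScan_minorised (hw : Measurable w) (hm : 0 < m) (hwm : ∀ ω, m ≤ w ω) (hwM : ∀ ω, w ω ≤ M)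
    (hc : ∀ i x, c • μ i ≤ P i x) {l : List ι} (hl : ∀ i, i ∈ l) (ω : Π j, X j) :
    (c * ENNReal.ofReal (m / M)) ^ l.length • Measure.pi μ ≤ cycle (l.map (siteMetropolis P w)) ω := by
  have h2 : List.Forall₂ (fun κ Φ => ∀ a, (c * ENNReal.ofReal (m / M)) • Φ a ≤ κ a)
      (l.map (siteMetropolis P w)) (l.map (refresh μ)) :=
    List.forall₂_map_left_iff.2 (List.forall₂_map_right_iff.2
      (List.forall₂_same.2 fun i _ a => siteMetropolis_ge_refresh hw hm hwm hwM hc i a))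
  have h := cycle_minorised h2 ω
  rwa [List.length_map, cycle_refresh_eq_const hl, Kernel.const_apply] at h

omit [Fintype ι] in
/-- Every Metropolis scan is a Markov kernel. -/
theorem isMarkovKernel_metropolisScan (hw : Measurable w) (l : List ι) :
    IsMarkovKernel (cycle (l.map (siteMetropolis P w))) := by
  refine isMarkovKernel_cycle fun κ hκ => ?_
  obtain ⟨i, -, rfl⟩ := List.mem_map.1 hκ
  exact isMarkovKernel_siteMetropolis hw i

/-- The Gibbs law `Z⁻¹ w · ⊗μ` is invariant under every Metropolis scan. -/
theorem metropolisScan_invariant_piGibbsLaw (hw : Measurable w) (hw0 : ∀ ω, 0 < w ω)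
    (hP : ∀ i, ((μ i) ⊗ₘ P i).map Prod.swap = (μ i) ⊗ₘ P i) (l : List ι) :
    Kernel.Invariant (cycle (l.map (siteMetropolis P w))) (piGibbsLaw μ fun ω => ENNReal.ofReal (w ω)) :=
  invariant_smul (metropolisScan_invariant hw hw0 hP l) _

/-- **THE METROPOLIS SCAN IS UNIFORMLY ERGODIC.**  Finite product of probability spaces, measurable
weight `0 < m ≤ w ≤ M`, `μ_i`-symmetric Markov proposals dominating `c • μ_i` from every point, a list
`l` of sites containing every site: `|μ₀Kᵗ(A) − π(A)| ≤ (1 − (c·m/M)^{|l|})ᵗ` for EVERY initial law,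
`π = piGibbsLaw μ (ofReal ∘ w)`. -/
theorem metropolisScan_uniformlyErgodic (hw : Measurable w) (hm : 0 < m) (hwm : ∀ ω, m ≤ w ω)
    (hwM : ∀ ω, w ω ≤ M) (hP : ∀ i, ((μ i) ⊗ₘ P i).map Prod.swap = (μ i) ⊗ₘ P i)
    (hc : ∀ i x, c • μ i ≤ P i x) {l : List ι} (hl : ∀ i, i ∈ l)
    (μ₀ : Measure (Π j, X j)) [IsProbabilityMeasure μ₀] (t : ℕ) (A : Set (Π j, X j)) :
    |((fun ν : Measure (Π j, X j) => ν.bind (cycle (l.map (siteMetropolis P w))))^[t] μ₀).real A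
        - (piGibbsLaw μ fun ω => ENNReal.ofReal (w ω)).real A| ≤
      (1 - ((c * ENNReal.ofReal (m / M)) ^ l.length).toReal) ^ t := by
  haveI := isMarkovKernel_metropolisScan (P := P) hw l
  haveI := isProbabilityMeasure_piGibbsLaw (μ := μ) (p := fun ω => ENNReal.ofReal (w ω))
    (m := ENNReal.ofReal m) (M := ENNReal.ofReal M) (by rwa [Ne, ENNReal.ofReal_eq_zero, not_le]) ENNReal.ofReal_ne_top
    (fun ω => ENNReal.ofReal_le_ofReal (hwm ω)) (fun ω => ENNReal.ofReal_le_ofReal (hwM ω))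
  exact uniformlyErgodic_of_minorised (metropolisScan_minorised (μ := μ) hw hm hwm hwM hc hl)
    (metropolisScan_invariant_piGibbsLaw (μ := μ) hw (fun ω => hm.trans_le (hwm ω)) hP l) μ₀ t A

/-- **The Gibbs law is the unique invariant probability law of the Metropolis scan** (same hypotheses,
`c ≠ 0`). -/
theorem metropolisScan_invariant_unique (hw : Measurable w) (hm : 0 < m) (hwm : ∀ ω, m ≤ w ω)
    (hwM : ∀ ω, w ω ≤ M) (hP : ∀ i, ((μ i) ⊗ₘ P i).map Prod.swap = (μ i) ⊗ₘ P i)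
    (hc0 : c ≠ 0) (hc : ∀ i x, c • μ i ≤ P i x) {l : List ι} (hl : ∀ i, i ∈ l)
    {π' : Measure (Π j, X j)} [IsProbabilityMeasure π']
    (hπ' : Kernel.Invariant (cycle (l.map (siteMetropolis P w))) π') :
    π' = piGibbsLaw μ fun ω => ENNReal.ofReal (w ω) := by
  haveI := isMarkovKernel_metropolisScan (P := P) hw l
  haveI := isProbabilityMeasure_piGibbsLaw (μ := μ) (p := fun ω => ENNReal.ofReal (w ω))
    (m := ENNReal.ofReal m) (M := ENNReal.ofReal M) (by rwa [Ne, ENNReal.ofReal_eq_zero, not_le]) ENNReal.ofReal_ne_top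
    (fun ω => ENNReal.ofReal_le_ofReal (hwm ω)) (fun ω => ENNReal.ofReal_le_ofReal (hwM ω))
  obtain ⟨ω₀⟩ := nonempty_of_isProbabilityMeasure π'
  have hM : 0 < M := hm.trans_le ((hwm ω₀).trans (hwM ω₀))
  have hmM : ENNReal.ofReal (m / M) ≠ 0 := by
    rw [Ne, ENNReal.ofReal_eq_zero, not_le]; exact div_pos hm hM
  have hε : 0 < (c * ENNReal.ofReal (m / M)) ^ l.length :=
    pos_iff_ne_zero.2 (pow_ne_zero _ (mul_ne_zero hc0 hmM))
  exact invariant_unique_of_minorised (metropolisScan_minorised (μ := μ) hw hm hwm hwM hc hl) hε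
    (metropolisScan_invariant_piGibbsLaw (μ := μ) hw (fun ω => hm.trans_le (hwm ω)) hP l) hπ'

/-- **… and so is the composite sweep "Metropolis scan, then any exact update"**: for every Markov
kernel `η` leaving `w · ⊗μ` invariant (over-relaxation sweeps, measure-preserving reflections, further
exact hits), `η ∘ₖ K` obeys the same bound `|μ₀(ηK)ᵗ(A) − π(A)| ≤ (1 − (c·m/M)^{|l|})ᵗ`. -/
theorem metropolisScan_comp_uniformlyErgodic (hw : Measurable w) (hm : 0 < m) (hwm : ∀ ω, m ≤ w ω)
    (hwM : ∀ ω, w ω ≤ M) (hP : ∀ i, ((μ i) ⊗ₘ P i).map Prod.swap = (μ i) ⊗ₘ P i)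
    (hc : ∀ i x, c • μ i ≤ P i x) {l : List ι} (hl : ∀ i, i ∈ l)
    (η : Kernel (Π j, X j) (Π j, X j)) [IsMarkovKernel η]
    (hη : Kernel.Invariant η ((Measure.pi μ).withDensity fun ω => ENNReal.ofReal (w ω)))
    (μ₀ : Measure (Π j, X j)) [IsProbabilityMeasure μ₀] (t : ℕ) (A : Set (Π j, X j)) :
    |((fun ν : Measure (Π j, X j) => ν.bind (η ∘ₖ cycle (l.map (siteMetropolis P w))))^[t] μ₀).real A
        - (piGibbsLaw μ fun ω => ENNReal.ofReal (w ω)).real A| ≤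
      (1 - ((c * ENNReal.ofReal (m / M)) ^ l.length).toReal) ^ t := by
  haveI := isMarkovKernel_metropolisScan (P := P) hw l
  haveI := isProbabilityMeasure_piGibbsLaw (μ := μ) (p := fun ω => ENNReal.ofReal (w ω))
    (m := ENNReal.ofReal m) (M := ENNReal.ofReal M) (by rwa [Ne, ENNReal.ofReal_eq_zero, not_le]) ENNReal.ofReal_ne_top
    (fun ω => ENNReal.ofReal_le_ofReal (hwm ω)) (fun ω => ENNReal.ofReal_le_ofReal (hwM ω))
  have hmin := fun a => minorised_comp_left (metropolisScan_minorised (μ := μ) hw hm hwm hwM hc hl) η a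
  have hinv : Kernel.Invariant (η ∘ₖ cycle (l.map (siteMetropolis P w))) (piGibbsLaw μ fun ω => ENNReal.ofReal (w ω)) :=
    (invariant_smul hη _).comp (metropolisScan_invariant_piGibbsLaw (μ := μ) hw (fun ω => hm.trans_le (hwm ω)) hP l)
  exact uniformlyErgodic_of_minorised hmin hinv μ₀ t A

end Site

end Summit.Ventures.LatticeQCDFlow.Exactness
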